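import Mathlib
import Summits.KontsevichZagierPeriods.KontsevichZagierPeriods.Theses.InverseLandau

/-!
# `TateLifting`, line `Sketch`, stub `stub_polynomialArc` — the polynomial-arc lemma from density

Crux stmt-KontsevichZagierPeriods-9129 (`Summit.KontsevichZagierPeriods.KontsevichZagierPeriods.Theses.InverseLandau.TateLifting`).
From the density statement `RatPolyDense` (hypothesis; it is stub `stub_ratPolyDense`, proved
separately): for real-algebraic `θ > 0` with no conjugate in `(0,θ)`, a point `a ∈ ℚ[θ]^k`, an open
`U ⊆ ℝ^k` and a continuous path `γ : [0,θ] → U` from the corner `0` to `a`, there is a polynomial arc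
`p ∈ ℚ[X]^k` with `p(0) = 0`, `p(θ) = a`, `p([0,θ]) ⊆ U`.

Proof: `m := minpoly ℚ θ` has `m(θ) = 0`, `m(0) ≠ 0` (`minpoly.coeff_zero_ne_zero`); base
interpolants `p⁰ⱼ := qⱼ − C (qⱼ(0)/m(0)) · m` satisfy `p⁰ⱼ(0) = 0`, `p⁰ⱼ(θ) = aⱼ`; the compact
`γ([0,θ])` has a uniform margin `ρ > 0` inside `U` (sup metric on `Fin k → ℝ`); apply density to
`gⱼ := γⱼ − p⁰ⱼ` (continuous, vanishing at `0` and `θ`) with tolerance `ρ`, and put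
`pⱼ := p⁰ⱼ + X · m · qⱼ`.
-/

noncomputable section

namespace Summit.KontsevichZagierPeriods.InverseLandau

open Literature.NumberTheory.Transcendental

/-- **The polynomial-arc lemma, from rational Weierstrass with pinned nodes** (stub
`stub_polynomialArc` of line `Sketch` for crux `TateLifting`). [folklore] -/
theorem tateLifting_polynomialArc :
    (∀ (θ : ℝ) (g : ℝ → ℝ) (ε : ℝ), IsAlgebraic ℚ θ → 0 < θ → 0 < ε →
      (∀ t ∈ Set.Ioo (0 : ℝ) θ, Polynomial.aeval t (minpoly ℚ θ) ≠ 0) →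
      ContinuousOn g (Set.Icc 0 θ) → g 0 = 0 → g θ = 0 →
      ∃ q : Polynomial ℚ, ∀ t ∈ Set.Icc (0 : ℝ) θ,
        |g t - t * Polynomial.aeval t (minpoly ℚ θ) * Polynomial.aeval t q| < ε) →
    ∀ (k : ℕ) (θ : ℝ) (a : Fin k → ℝ) (U : Set (Fin k → ℝ)) (γ : ℝ → (Fin k → ℝ)),
      IsAlgebraic ℚ θ → 0 < θ → (∀ t ∈ Set.Ioo (0 : ℝ) θ, Polynomial.aeval t (minpoly ℚ θ) ≠ 0) →
      (∀ j, ∃ q : Polynomial ℚ, Polynomial.aeval θ q = a j) → IsOpen U →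
      ContinuousOn γ (Set.Icc 0 θ) → γ 0 = 0 → γ θ = a → (∀ t ∈ Set.Icc (0 : ℝ) θ, γ t ∈ U) →
      ∃ p : Fin k → Polynomial ℚ, (∀ j, Polynomial.aeval (0 : ℝ) (p j) = 0) ∧
        (∀ j, Polynomial.aeval θ (p j) = a j) ∧
        ∀ t ∈ Set.Icc (0 : ℝ) θ, (fun j => Polynomial.aeval t (p j)) ∈ U := by
  intro hdense k θ a U γ hθalg hθpos hsep hq hU hγ hγ0 hγθ hγU
  -- (a) the minimal polynomial vanishes at `θ` and not at `0`
  have hint : IsIntegral ℚ θ := hθalg.isIntegral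
  have hmθ : Polynomial.aeval θ (minpoly ℚ θ) = 0 := minpoly.aeval ℚ θ
  have hm0 : (minpoly ℚ θ).coeff 0 ≠ 0 := minpoly.coeff_zero_ne_zero hint hθpos.ne'
  have haeval0 : ∀ q : Polynomial ℚ,
      Polynomial.aeval (0 : ℝ) q = algebraMap ℚ ℝ (q.coeff 0) := fun q =>
    (Polynomial.coeff_zero_eq_aeval_zero' q).symm
  -- (b) base interpolants through the corner and the point
  choose q hq using hq
  obtain ⟨p₀, hp₀0, hp₀θ⟩ : ∃ p₀ : Fin k → Polynomial ℚ,
      (∀ j, Polynomial.aeval (0 : ℝ) (p₀ j) = 0) ∧ ∀ j, Polynomial.aeval θ (p₀ j) = a j := by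
    refine ⟨fun j => q j - Polynomial.C ((q j).coeff 0 / (minpoly ℚ θ).coeff 0) * minpoly ℚ θ,
      fun j => ?_, fun j => ?_⟩
    · rw [haeval0]
      simp only [Polynomial.coeff_sub, Polynomial.coeff_C_mul, div_mul_cancel₀ _ hm0, sub_self,
        map_zero]
    · simp only [map_sub, map_mul, Polynomial.aeval_C, hmθ, mul_zero, sub_zero, hq]
  -- (c) a uniform margin of the compact arc inside the open set (sup metric)
  obtain ⟨ρ, hρ, hρU⟩ : ∃ ρ : ℝ, 0 < ρ ∧ ∀ t ∈ Set.Icc (0 : ℝ) θ, Metric.ball (γ t) ρ ⊆ U := by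
    have hK : IsCompact (γ '' Set.Icc 0 θ) := isCompact_Icc.image_of_continuousOn hγ
    have hKU : γ '' Set.Icc 0 θ ⊆ U := by
      rintro _ ⟨t, ht, rfl⟩
      exact hγU t ht
    obtain ⟨δ, hδ, hδU⟩ := hK.exists_thickening_subset_open hU hKU
    refine ⟨δ, hδ, fun t ht x hx => hδU ?_⟩
    exact Metric.mem_thickening_iff.2 ⟨γ t, ⟨t, ht, rfl⟩, Metric.mem_ball.1 hx⟩
  -- (d) density, coordinatewise, with tolerance `ρ`
  have hg : ∀ j, ∃ q' : Polynomial ℚ, ∀ t ∈ Set.Icc (0 : ℝ) θ,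
      |(γ t j - Polynomial.aeval t (p₀ j)) -
        t * Polynomial.aeval t (minpoly ℚ θ) * Polynomial.aeval t q'| < ρ := by
    intro j
    refine hdense θ (fun t => γ t j - Polynomial.aeval t (p₀ j)) ρ hθalg hθpos hρ hsep ?_ ?_ ?_
    · exact ((continuous_apply j).comp_continuousOn hγ).sub (p₀ j).continuousOn_aeval
    · simp [hγ0, hp₀0 j]
    · simp [hγθ, hp₀θ j]
  choose q' hq' using hg
  -- (e) the corrected arc
  refine ⟨fun j => p₀ j + Polynomial.X * minpoly ℚ θ * q' j, fun j => ?_, fun j => ?_,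
    fun t ht => ?_⟩
  · simp only [map_add, map_mul, Polynomial.aeval_X, hp₀0, zero_mul, add_zero]
  · simp only [map_add, map_mul, Polynomial.aeval_X, hp₀θ, hmθ, mul_zero, zero_mul, add_zero]
  · refine hρU t ht (Metric.mem_ball.2 ((dist_pi_lt_iff hρ).2 fun j => ?_))
    rw [Real.dist_eq]
    calc |Polynomial.aeval t (p₀ j + Polynomial.X * minpoly ℚ θ * q' j) - γ t j|
        = |(γ t j - Polynomial.aeval t (p₀ j)) -
            t * Polynomial.aeval t (minpoly ℚ θ) * Polynomial.aeval t (q' j)| := by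
          rw [← abs_neg]
          simp only [map_add, map_mul, Polynomial.aeval_X]
          ring_nf
      _ < ρ := hq' j t ht

end Summit.KontsevichZagierPeriods.InverseLandau

end
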